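import Summits.QuantumAdvantage.QuantumAdvantage.Theorems.LinnikCubicClassGroupsDegreeOnePrimesEscapeClassPNTTZForm
import Literature.NumberTheory.LFunctions.UniformClassGroupPNTGeneralDegreeReduction
import HarnessLib

/-!
# Thorner–Zaman (2019) Thm 1.4 for the Hilbert class field at a fixed degree: the `π_C`-form

Topic `Summits/QuantumAdvantage/QuantumAdvantage/Theorems`, cell B2b-1 (linnik-cubic), PART A (gen 32);
helper toward the crux `DegreeOnePrimesEscape` (stmt-QuantumAdvantage-11543) of route
`LinnikCubicClassGroups`.  HONEST FRAMING: the value of this file is a THEOREM (kernel-checked, GRH-free,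
Siegel-free) — NOT summit progress (the route still rests on the hypothesis-type target
`PureCubicClassNumberHard`).

`classPNT_TZ_dichotomy (n) (hn : 1 < n)`: **[ThornerZaman2019, Thm. 1.4] for `L = H_K`, `π_C`-form, with constants
depending on the degree `n` only** — there are `c₁, c₂, c₃ > 0` such that for every number field `K` of degree
`n` (`Q = |d_K| n^n`, `h = h_K`, `Li(x) = ∫₂ˣ dt/log t`, `E(x) = c₃ (e^{−c₂ log x/log Q} + e^{−(c₂ log x)^{1/2}/n^{1/2}})`):
EITHER no real class group character `χ` has a real zero of `L(s, χ)` in `1 − 1/(8 log Q) < s < 1` and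
`|π_C(x) − Li(x)/h| ≤ E(x) Li(x)/h` for every class `C` and `x ≥ Q^{c₁}`; OR there are a real `χ₁` and a real
zero `β₁ ∈ (1 − 1/(8 log Q), 1)` of `L(s, χ₁)` with `|π_C(x) − (Li(x) − χ₁(C) Li(x^{β₁}))/h| ≤ E(x)(Li(x) −
χ₁(C) Li(x^{β₁}))/h` for every `C`, `x ≥ Q^{c₁}`.  This is EXACTLY the statement of the tree's named fact
`ThornerZaman2019_classPNT_hilbertClassField` (`UniformClassGroupPNTGeneralDegree.lean`) restricted to ONE degree
`n` (the named fact asks for `c₁, c₂, c₃` uniform in `n`, which the per-degree density constants of the tree do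
not give; it is NOT claimed).  Proof: the `θ_C`-form `classTheta_TZ_dichotomy` (`…ClassPNTTZForm.lean`) and the
per-field partial-summation argument of `ThornerZaman2019_classPNT_hilbertClassField_of_thetaForm`
(`UniformClassGroupPNTGeneralDegreeReduction.lean`, [ThornerZaman2019, proof of Thm. 5.1]: Lemma 2.1, (4.8),
Lemma 2.4, absorption of `𝓔₀(x) ≪ x^{1/2}`), whose body is reproduced here for a single field.

References: J. Thorner, A. Zaman, *A unified and improved Chebotarev density theorem*, Algebra Number Theory 13
(2019) 1039–1068, Thm. 1.4, Lemma 2.1, Lemma 2.4, Thm. 5.1 [ThornerZaman2019]; A. Weiss, J. reine angew.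
Math. 338 (1983), Thm. 5.2 [Weiss1983].
-/

noncomputable section

open scoped NumberField
open Real MeasureTheory Set NumberField

namespace Summit.QuantumAdvantage.QuantumAdvantage.Theorems.DegreeOnePrimesEscape

open Literature.NumberTheory.LFunctions Literature.NumberTheory.LFunctions.NumberField

set_option maxHeartbeats 1600000 in
/-- **Thorner–Zaman (2019), Theorem 1.4, for `H_K/K` at a fixed degree `n > 1`, `π_C`-form** (see the module
docstring): the statement of the named fact `ThornerZaman2019_classPNT_hilbertClassField` for the number fields of
one degree `n`, with `c₁, c₂, c₃` depending on `n`. [cite: ThornerZaman2019, Theorem 1.4] [cite: Weiss1983, Theorem 5.2] -/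
theorem classPNT_TZ_dichotomy (n : ℕ) (hn : 1 < n) :
    ∃ c₁ c₂ c₃ : ℝ, 0 < c₁ ∧ 0 < c₂ ∧ 0 < c₃ ∧
    ∀ (K : Type) [Field K] [NumberField K], Module.finrank ℚ K = n →
      (((∀ χ : ClassGroup (𝓞 K) →* ℂˣ, χ * χ = 1 →
            ∀ β : ℝ, 1 - 1 / (8 * Real.log (ThornerZaman.condQn K)) < β → β < 1 →
              classGroupLFunction K χ β ≠ 0) ∧
          ∀ (C : ClassGroup (𝓞 K)) (x : ℝ), ThornerZaman.condQn K ^ c₁ ≤ x →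
            |(primeIdealClassCount K C x : ℝ) - offsetLogIntegral x / NumberField.classNumber K| ≤
              c₃ * ThornerZaman.errorTermN c₂ (ThornerZaman.condQn K) n x *
                (offsetLogIntegral x / NumberField.classNumber K)) ∨
        ∃ (χ₁ : ClassGroup (𝓞 K) →* ℂˣ) (β₁ : ℝ), χ₁ * χ₁ = 1 ∧
          1 - 1 / (8 * Real.log (ThornerZaman.condQn K)) < β₁ ∧ β₁ < 1 ∧
          classGroupLFunction K χ₁ β₁ = 0 ∧
          ∀ (C : ClassGroup (𝓞 K)) (x : ℝ), ThornerZaman.condQn K ^ c₁ ≤ x →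
            |(primeIdealClassCount K C x : ℝ) -
                (offsetLogIntegral x - ((χ₁ C : ℂ)).re * offsetLogIntegral (x ^ β₁)) /
                  NumberField.classNumber K| ≤
              c₃ * ThornerZaman.errorTermN c₂ (ThornerZaman.condQn K) n x *
                ((offsetLogIntegral x - ((χ₁ C : ℂ)).re * offsetLogIntegral (x ^ β₁)) /
                  NumberField.classNumber K)) := by
  obtain ⟨a, c, A, s, ha, hc, hA, hs, hH⟩ := classTheta_TZ_dichotomy n hn
  have hc'0 : 0 < min c 1 := lt_min hc one_pos
  have hc'1 : min c 1 ≤ 1 := min_le_right _ _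
  have hc'c : min c 1 ≤ c := min_le_left _ _
  refine ⟨max (2 * a) (72 + 8 * s), min c 1 / 2, 30 * A + 1, by positivity, by positivity,
    by positivity, ?_⟩
  intro K _ _ hKn
  have hK : 1 < Module.finrank ℚ K := by rw [hKn]; exact hn
  have hHK := hH K hKn
  subst hKn
  -- notation: the degree (as in `ThornerZaman2019_classPNT_hilbertClassField_of_thetaForm`)
  set n : ℕ := Module.finrank ℚ K with hn
  -- constants of the field
  have hQ12 : 12 ≤ ThornerZaman.condQn K := ThornerZaman.twelve_le_condQn hK
  have hQ1 : 1 < ThornerZaman.condQn K := by linarith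
  have hQ0 : 0 < ThornerZaman.condQn K := by linarith
  have hq2 : 2 < Real.log (ThornerZaman.condQn K) :=
    two_lt_log_twelve.trans_le (Real.log_le_log (by norm_num) hQ12)
  have hh1 : (1 : ℝ) ≤ classNumber K := by exact_mod_cast one_le_classNumber
  have hh0 : (0 : ℝ) < classNumber K := by linarith
  have hhQ : (classNumber K : ℝ) ≤ ThornerZaman.condQn K ^ (4 : ℕ) :=
    ThornerZaman.classNumber_le_condQn_pow hK
  have hn2 : (2 : ℝ) ≤ n := by exact_mod_cast hK
  have hn1 : (1 : ℝ) ≤ n := by linarith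
  have hnQ : (n : ℝ) ≤ ThornerZaman.condQn K := ThornerZaman.finrank_le_condQn
  -- Chebyshev, uniformly: `θ_C(t) ≤ n (log 4 + 4) t`
  have hlog4 : Real.log 4 ≤ 1.5 := by
    have : Real.log 4 = 2 * Real.log 2 := by
      rw [show (4 : ℝ) = 2 ^ 2 by norm_num, Real.log_pow]; norm_num
    rw [this]
    linarith [Real.log_two_lt_d9]
  have hlog40 : 0 ≤ Real.log 4 := Real.log_nonneg (by norm_num)
  have hB0 : (0 : ℝ) ≤ n * (Real.log 4 + 4) := by positivity
  have hTB : ∀ (C : ClassGroup (𝓞 K)) (t : ℝ), 2 ≤ t →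
      chebyshevThetaIdealClass K C t ≤ n * (Real.log 4 + 4) * t := by
    intro C t ht
    refine (chebyshevThetaIdealClass_le_chebyshevThetaIdeal C t).trans ?_
    exact_mod_cast chebyshevThetaIdeal_le_mul K (x := t) (by linarith)
  -- the error term with `c' = min c 1`, non-increasing, and dominating the one with `c`
  have hEanti : AntitoneOn (ThornerZaman.errorTermN (min c 1) (ThornerZaman.condQn K) n) (Ici 2) :=
    (ThornerZaman.errorTermN_antitoneOn hc'0.le hQ1 n).mono (Ici_subset_Ici.mpr one_le_two)
  have hE0 : ∀ t : ℝ, 2 ≤ t → 0 ≤ ThornerZaman.errorTermN (min c 1) (ThornerZaman.condQn K) n t :=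
    fun t _ ↦ (ThornerZaman.errorTermN_pos _ _ _ _).le
  have hEc : ∀ t : ℝ, 1 ≤ t → ThornerZaman.errorTermN c (ThornerZaman.condQn K) n t ≤
      ThornerZaman.errorTermN (min c 1) (ThornerZaman.condQn K) n t :=
    fun t ht ↦ ThornerZaman.errorTermN_le_of_le hc'c hQ1 n ht
  -- the range `x ≥ Q^{c₁}`
  have hrange : ∀ x : ℝ, ThornerZaman.condQn K ^ max (2 * a) (72 + 8 * s) ≤ x →
      0 < x ∧ 256 ≤ x ∧ (max 2 (ThornerZaman.condQn K ^ a)) ^ 2 ≤ x ∧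
        (72 + 8 * s) * Real.log (ThornerZaman.condQn K) ≤ Real.log x := by
    intro x hx
    have hxpos : 0 < x := lt_of_lt_of_le (Real.rpow_pos_of_pos hQ0 _) hx
    have h2a : ThornerZaman.condQn K ^ (2 * a) ≤ x :=
      (Real.rpow_le_rpow_of_exponent_le hQ1.le (le_max_left _ _)).trans hx
    have h72 : ThornerZaman.condQn K ^ (72 + 8 * s) ≤ x :=
      (Real.rpow_le_rpow_of_exponent_le hQ1.le (le_max_right _ _)).trans hx
    have hlog : (72 + 8 * s) * Real.log (ThornerZaman.condQn K) ≤ Real.log x := by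
      rw [← Real.log_rpow hQ0]
      exact Real.log_le_log (Real.rpow_pos_of_pos hQ0 _) h72
    have h256 : 256 ≤ x := by
      have hl256 : Real.log 256 ≤ Real.log x := by
        have : Real.log 256 = 8 * Real.log 2 := by
          rw [show (256 : ℝ) = 2 ^ 8 by norm_num, Real.log_pow]; norm_num
        have hsq : 0 ≤ s * Real.log (ThornerZaman.condQn K) := by positivity
        have h144 : (144 : ℝ) ≤ Real.log x := by nlinarith
        linarith [Real.log_two_lt_d9]
      exact (Real.log_le_log_iff (by norm_num) hxpos).mp hl256
    refine ⟨hxpos, h256, ?_, hlog⟩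
    rcases le_total 2 (ThornerZaman.condQn K ^ a) with hm | hm
    · rw [max_eq_right hm, ← Real.rpow_natCast, ← Real.rpow_mul hQ0.le]
      rw [show a * ((2 : ℕ) : ℝ) = 2 * a by push_cast; ring]
      exact h2a
    · rw [max_eq_left hm]
      linarith
  have hy2 : (2 : ℝ) ≤ max 2 (ThornerZaman.condQn K ^ a) := le_max_left _ _
  -- the junk constant: `3 n (log 4 + 4) + 19/h ≤ 26 n`
  have hB26 : ∀ x : ℝ, (3 * (n * (Real.log 4 + 4)) + 19 / classNumber K) * Real.sqrt x ≤
      26 * n * Real.sqrt x := by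
    intro x
    refine mul_le_mul_of_nonneg_right ?_ (Real.sqrt_nonneg _)
    have : 19 / (classNumber K : ℝ) ≤ 19 := div_le_self (by norm_num) hh1
    nlinarith
  -- the dichotomy
  rcases hHK with ⟨hzf, hθ⟩ | ⟨χ₁, β₁, hχ₁, hβl, hβu, hL0, hstark, hθ⟩
  · -- no exceptional zero
    refine Or.inl ⟨hzf, fun C x hx ↦ ?_⟩
    obtain ⟨hx0, hx256, hyx, hlogx⟩ := hrange x hx
    have hx2 : (2 : ℝ) ≤ x := by linarith
    have hTE : ∀ t : ℝ, max 2 (ThornerZaman.condQn K ^ a) ≤ t →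
        |chebyshevThetaIdealClass K C t - (t - 0 * t ^ (1 : ℝ) / 1) / classNumber K| ≤
          A * ThornerZaman.errorTermN (min c 1) (ThornerZaman.condQn K) n t *
            ((t - 0 * t ^ (1 : ℝ) / 1) / classNumber K) := by
      intro t ht
      have ht2 : 2 ≤ t := hy2.trans ht
      have hta : ThornerZaman.condQn K ^ a ≤ t := (le_max_right _ _).trans ht
      have h1 := hθ C t hta
      simp only [zero_mul, zero_div, sub_zero]
      refine h1.trans (mul_le_mul_of_nonneg_right (mul_le_mul_of_nonneg_left
        (hEc t (by linarith)) hA.le) (by positivity))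
    have hT := abs_sub_exceptionalLiMain_le (T := chebyshevThetaIdealClass K C)
      (E := ThornerZaman.errorTermN (min c 1) (ThornerZaman.condQn K) n)
      (P := (primeIdealClassCount K C x : ℝ)) (h := classNumber K) (θ₁ := 0) (β := 1) (A := A)
      (B := n * (Real.log 4 + 4)) (y := max 2 (ThornerZaman.condQn K ^ a)) (x := x) hh0
      (by norm_num) (by norm_num) le_rfl hA.le hB0 hy2
      (fun t _ ↦ chebyshevThetaIdealClass_nonneg C t) (hTB C) hEanti hE0 hTE hx256 hyx
      ((intervalIntegrable_iff_integrableOn_Icc_of_le hx2).mpr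
        (integrableOn_chebyshevThetaIdealClass_div K C x))
      (primeIdealClassCount_eq_theta_div_log_add_integral K C hx2)
    simp only [zero_mul, sub_zero] at hT
    rw [ThornerZaman.errorTermN_sqrt _ _ _ hx0.le] at hT
    -- absorption
    have hjunk := junk_le_errorTermN_mul n hQ12 hh1 hhQ hn1 hnQ hs.le hc'1 hx0 hlogx
    have hLi : x * ThornerZaman.condQn K ^ (-s) / (4 * classNumber K * Real.log x) ≤
        offsetLogIntegral x / classNumber K := by
      have hL : 0 < Real.log x := Real.log_pos (by linarith)
      have h1 : ThornerZaman.condQn K ^ (-s) ≤ 1 :=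
        Real.rpow_le_one_of_one_le_of_nonpos hQ1.le (by linarith)
      have h2' := div_two_mul_log_le_offsetLogIntegral hx256
      rw [div_le_div_iff₀ (by positivity) hh0]
      rw [div_le_iff₀ (by positivity)] at h2'
      have h3 : x * ThornerZaman.condQn K ^ (-s) ≤ x * 1 :=
        mul_le_mul_of_nonneg_left h1 hx0.le
      nlinarith [mul_nonneg hh0.le hL.le]
    have hE'0 : 0 ≤ ThornerZaman.errorTermN (min c 1 / 2) (ThornerZaman.condQn K) n x :=
      (ThornerZaman.errorTermN_pos _ _ _ _).le
    have hfin : (3 * (n * (Real.log 4 + 4)) + 19 / classNumber K) * Real.sqrt x ≤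
        ThornerZaman.errorTermN (min c 1 / 2) (ThornerZaman.condQn K) n x *
          (offsetLogIntegral x / classNumber K) :=
      (hB26 x).trans (hjunk.trans (mul_le_mul_of_nonneg_left hLi hE'0))
    have hmain0 : 0 ≤ A * ThornerZaman.errorTermN (min c 1 / 2) (ThornerZaman.condQn K) n x *
        (offsetLogIntegral x / classNumber K) := by
      have hL : 0 < Real.log x := Real.log_pos (by linarith)
      have : 0 ≤ offsetLogIntegral x / classNumber K :=
        div_nonneg ((div_nonneg hx0.le (by positivity)).trans
          (div_two_mul_log_le_offsetLogIntegral hx256)) hh0.le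
      positivity
    nlinarith
  · -- an exceptional zero `β₁` of the real character `χ₁`
    refine Or.inr ⟨χ₁, β₁, hχ₁, hβl, hβu, hL0, fun C x hx ↦ ?_⟩
    obtain ⟨hx0, hx256, hyx, hlogx⟩ := hrange x hx
    have hx2 : (2 : ℝ) ≤ x := by linarith
    have hθ1 : ((χ₁ C : ℂ)).re = 1 ∨ ((χ₁ C : ℂ)).re = -1 := re_classGroupChar_apply hχ₁ C
    have hθabs : |((χ₁ C : ℂ)).re| ≤ 1 := abs_re_classGroupChar_apply_le hχ₁ C
    have hβhalf : 1 / 2 < β₁ := by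
      have h16 : 1 / (8 * Real.log (ThornerZaman.condQn K)) ≤ 1 / 16 :=
        one_div_le_one_div_of_le (by norm_num) (by linarith)
      linarith
    have hTE : ∀ t : ℝ, max 2 (ThornerZaman.condQn K ^ a) ≤ t →
        |chebyshevThetaIdealClass K C t -
            (t - ((χ₁ C : ℂ)).re * t ^ β₁ / β₁) / classNumber K| ≤
          A * ThornerZaman.errorTermN (min c 1) (ThornerZaman.condQn K) n t *
            ((t - ((χ₁ C : ℂ)).re * t ^ β₁ / β₁) / classNumber K) := by
      intro t ht
      have ht2 : 2 ≤ t := hy2.trans ht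
      have hta : ThornerZaman.condQn K ^ a ≤ t := (le_max_right _ _).trans ht
      have h1 := hθ C t hta
      have hg0 : 0 ≤ (t - ((χ₁ C : ℂ)).re * t ^ β₁ / β₁) / classNumber K := by
        -- from `h1`: `0 ≤ |…| ≤ A E g/h` with `A E > 0`
        have hAE : 0 < A * ThornerZaman.errorTermN c (ThornerZaman.condQn K) n t :=
          mul_pos hA (ThornerZaman.errorTermN_pos _ _ _ _)
        refine le_of_mul_le_mul_left ?_ hAE
        rw [mul_zero]
        exact (abs_nonneg _).trans h1
      exact h1.trans (mul_le_mul_of_nonneg_right (mul_le_mul_of_nonneg_left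
        (hEc t (by linarith)) hA.le) hg0)
    have hT := abs_sub_exceptionalLiMain_le (T := chebyshevThetaIdealClass K C)
      (E := ThornerZaman.errorTermN (min c 1) (ThornerZaman.condQn K) n)
      (P := (primeIdealClassCount K C x : ℝ)) (h := classNumber K) (θ₁ := ((χ₁ C : ℂ)).re)
      (β := β₁) (A := A) (B := n * (Real.log 4 + 4)) (y := max 2 (ThornerZaman.condQn K ^ a))
      (x := x) hh0 hθabs hβhalf hβu.le hA.le hB0 hy2
      (fun t _ ↦ chebyshevThetaIdealClass_nonneg C t) (hTB C) hEanti hE0 hTE hx256 hyx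
      ((intervalIntegrable_iff_integrableOn_Icc_of_le hx2).mpr
        (integrableOn_chebyshevThetaIdealClass_div K C x))
      (primeIdealClassCount_eq_theta_div_log_add_integral K C hx2)
    rw [ThornerZaman.errorTermN_sqrt _ _ _ hx0.le] at hT
    -- absorption, using Stark's bound through `exceptionalLiMain_ge`
    have hjunk := junk_le_errorTermN_mul n hQ12 hh1 hhQ hn1 hnQ hs.le hc'1 hx0 hlogx
    have hδ1 : ThornerZaman.condQn K ^ (-s) ≤ 1 :=
      Real.rpow_le_one_of_one_le_of_nonpos hQ1.le (by linarith)
    have hG := exceptionalLiMain_ge hθ1 hβhalf hβu (Real.rpow_pos_of_pos hQ0 _) hδ1 hstark hx256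
    have hLi : x * ThornerZaman.condQn K ^ (-s) / (4 * classNumber K * Real.log x) ≤
        (offsetLogIntegral x - ((χ₁ C : ℂ)).re * offsetLogIntegral (x ^ β₁)) / classNumber K := by
      have hL : 0 < Real.log x := Real.log_pos (by linarith)
      rw [show x * ThornerZaman.condQn K ^ (-s) / (4 * classNumber K * Real.log x) =
        x * ThornerZaman.condQn K ^ (-s) / (4 * Real.log x) / classNumber K by
          field_simp]
      exact div_le_div_of_nonneg_right hG hh0.le
    have hE'0 : 0 ≤ ThornerZaman.errorTermN (min c 1 / 2) (ThornerZaman.condQn K) n x :=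
      (ThornerZaman.errorTermN_pos _ _ _ _).le
    have hfin : (3 * (n * (Real.log 4 + 4)) + 19 / classNumber K) * Real.sqrt x ≤
        ThornerZaman.errorTermN (min c 1 / 2) (ThornerZaman.condQn K) n x *
          ((offsetLogIntegral x - ((χ₁ C : ℂ)).re * offsetLogIntegral (x ^ β₁)) /
            classNumber K) :=
      (hB26 x).trans (hjunk.trans (mul_le_mul_of_nonneg_left hLi hE'0))
    have hG0 : 0 ≤ (offsetLogIntegral x - ((χ₁ C : ℂ)).re * offsetLogIntegral (x ^ β₁)) /
        classNumber K := by
      refine div_nonneg (le_trans ?_ hG) hh0.le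
      have : 0 < Real.log x := Real.log_pos (by linarith)
      positivity
    have hmain0 : 0 ≤ A * ThornerZaman.errorTermN (min c 1 / 2) (ThornerZaman.condQn K) n x *
        ((offsetLogIntegral x - ((χ₁ C : ℂ)).re * offsetLogIntegral (x ^ β₁)) /
          classNumber K) := by positivity
    nlinarith

-- (re-landed 2026-08-24 unchanged: the hub build lane lost the olean of the 2026-08-23 accept; see STATUS of cell linnik-cubic)

end Summit.QuantumAdvantage.QuantumAdvantage.Theorems.DegreeOnePrimesEscape

end
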